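import Literature.NumberTheory.DiophantineGeometry.PlaneSectionRefinedEstimateProofs
import Literature.NumberTheory.DiophantineGeometry.CafureMateraThm52NumericsProofs
import Literature.NumberTheory.DiophantineGeometry.CafureMateraThm52SmallDegreeProofs
import Literature.NumberTheory.DiophantineGeometry.PlaneSectionSmallFactorCountProofs
import HarnessLib

/-!
# Cafure–Matera (2006), Theorem 5.2, for hypersurfaces of degree `δ ≥ 9` (plane-section route)

Library file (theorems only). The named fact `CafureMatera2006_thm52` is discharged in the tree by
`CafureMateraThm52Proofs.CafureMatera2006_thm52_holds` (parametrisation `f(p + Xv + Yw)`,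
`(p, v, w) ∈ (Kⁿ)³`). This file closes the second, independent route through the sections
`planeSection f ν ω η = f(X + ν₀, ωᵢX + ηᵢY + ν_{i+1})` of `PlaneSectionCountingProofs` …
`PlaneSectionRefinedEstimateProofs`, for all degrees `δ ≥ 9` (degrees `δ ≤ 8`:
`CafureMateraThm52SmallDegreeProofs`).

Let `K = 𝔽_q`, `f ∈ K[x₀, …, xₘ]` (`m ≥ 1`) absolutely irreducible of total degree `δ ≥ 9` with
`q > 5δ^{10/3}`. Assume the **graded count of Cor. 3.4** for `f`: for
`1 ≤ D ≤ δ - 1` the number of parameters `(ν, ω, η) ∈ K^{m+1} × Kᵐ × Kᵐ` that are `D`-bad (the plane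
section `f_{ν,ω,η}` is constant, or its image in `K̄[x₀, x₁]` has a non-unit divisor of total degree
`≤ D`) is at most `(2δ² + δ (D+1)² 2Dδ) q^{3m}` — the count delivered by the degree-`D` certificate
of the tree (`BertiniSmallDegreeCertificateProofs.exists_noSmallFactor_certificate`, degree
`≤ δ (D+1)² 2Dδ`) fibre by fibre over the good `(ν, ω)` of Kaltofen's `Υ` (`deg Υ ≤ 2δ²`). Then
(`abs_rationalPointCount_sub_le_of_degreeCount`)

  `|N(f) - qᵐ| ≤ (δ-1)(δ-2) q^{m-1} √q + 5 δ^{13/3} q^{m-1}`.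

Proof: the refined averaging estimate `PlaneSectionRefinedEstimateProofs.mul_abs_sub_le_graded`
bounds `q^{m+2}(qᵐ-1)|N - qᵐ|` by `qᵐ(qᵐ-1)q^{m+1} W + δ² q^{3m+1} + q ∑_{j=1}^{δ-1} B_j` with `B_j`
the number of parameters that are not absolutely irreducible and `⌊δ/(j+1)⌋`-bad; `B_j` is at most
the count of Cor. 3.2 (`PlaneSectionBadParameterCountProofs`) and at most the assumed count for
`D = ⌊δ/(j+1)⌋`, and the resulting numerical inequality is
`CafureMateraThm52NumericsProofs.numeric_main`. This is (21)–(22) of the printed proof with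
Prop. 4.1 in crude form. Finally `CafureMatera2006_thm52_of_nine_le` inserts the count of Cor. 3.4
(`PlaneSectionSmallFactorCountProofs.card_filter_smallFactorBad_le`) and removes the restrictions on
`n` and `q` (`CafureMateraProofs`): Theorem 5.2 for every absolutely irreducible `f` of degree `≥ 9`.

## References

* A. Cafure, G. Matera, *Improved explicit estimates on the number of solutions of equations over a
  finite field*, Finite Fields Appl. 12 (2006) 155–185, Thm. 5.2, §5.1 (21)–(22), Prop. 4.1,
  Cor. 3.2, Cor. 3.4. [CafureMatera2006]
-/

noncomputable section

open scoped Classical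
open MvPolynomial Literature.RingTheory.MvPolynomial

namespace Literature.NumberTheory.DiophantineGeometry

/-- `δ ≤ 5δ^{10/3}` for a natural number `δ`. [folklore] -/
theorem cast_le_five_mul_rpow (δ : ℕ) : (δ : ℝ) ≤ 5 * (δ : ℝ) ^ ((10 : ℝ) / 3) := by
  rcases Nat.eq_zero_or_pos δ with rfl | hδ
  · simp
  have h1 : (1 : ℝ) ≤ δ := by exact_mod_cast hδ
  have h : (δ : ℝ) ≤ (δ : ℝ) ^ ((10 : ℝ) / 3) := by
    calc (δ : ℝ) = (δ : ℝ) ^ (1 : ℝ) := (Real.rpow_one _).symm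
      _ ≤ (δ : ℝ) ^ ((10 : ℝ) / 3) := Real.rpow_le_rpow_of_exponent_le h1 (by norm_num)
  have h0 : (0 : ℝ) ≤ (δ : ℝ) ^ ((10 : ℝ) / 3) := by positivity
  linarith

section Main

variable {K : Type} [Field K] [Fintype K]

/-- **Cafure–Matera's estimate (22) for `δ ≥ 9`, from the graded count of Cor. 3.4.** Let
`K = 𝔽_q`, `f ∈ K[x₀, …, xₘ]` (`m ≥ 1`) absolutely irreducible of total degree `δ ≥ 9` with
`q > 5δ^{10/3}`, and assume that for every `1 ≤ D ≤ δ - 1` at most `(2δ² + δ(D+1)² 2Dδ) q^{3m}`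
parameters `(ν, ω, η) ∈ K^{m+1} × Kᵐ × Kᵐ` are `D`-bad. Then
`|N - qᵐ| ≤ (δ-1)(δ-2) q^{m-1} √q + 5δ^{13/3} q^{m-1}`.
[cite: CafureMatera2006, Thm. 5.2, (21)–(22), Prop. 4.1] -/
theorem abs_rationalPointCount_sub_le_of_degreeCount {m : ℕ} (hm : 1 ≤ m)
    {f : MvPolynomial (Fin (m + 1)) K} (hf : IsAbsIrreducible f) {δ : ℕ} (hδ9 : 9 ≤ δ)
    (hdeg : f.totalDegree = δ) (hq : 5 * (δ : ℝ) ^ ((10 : ℝ) / 3) < Fintype.card K)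
    (hcount : ∀ D : ℕ, 1 ≤ D → D + 1 ≤ δ →
      ((Finset.univ : Finset ((Fin (m + 1) → K) × (Fin m → K) × (Fin m → K))).filter fun p ↦
        ¬ (0 < (planeSection f p.1 p.2.1 p.2.2).totalDegree ∧
            ∀ H : MvPolynomial (Fin 2) (AlgebraicClosure K),
              H ∣ MvPolynomial.map (algebraMap K (AlgebraicClosure K))
                  (planeSection f p.1 p.2.1 p.2.2) →
                H.totalDegree ≤ D → IsUnit H)).card ≤
        (2 * δ ^ 2 + δ * ((D + 1) ^ 2 * (2 * D * δ))) * Fintype.card K ^ (3 * m)) :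
    |(rationalPointCount f : ℝ) - (Fintype.card K : ℝ) ^ m| ≤
      ((δ - 1) * (δ - 2) : ℕ) * (Fintype.card K : ℝ) ^ (m - 1) * √(Fintype.card K : ℝ) +
        5 * (δ : ℝ) ^ ((13 : ℝ) / 3) * (Fintype.card K : ℝ) ^ (m - 1) := by
  obtain ⟨k, rfl⟩ : ∃ k, m = k + 1 := ⟨m - 1, by omega⟩
  set q : ℕ := Fintype.card K with hq'
  have hδ2 : 2 ≤ δ := by omega
  have hq51 : 51 ≤ q := fiftyone_le_of_lt hδ2 hq
  have hδq : δ < q := by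
    have := (cast_le_five_mul_rpow δ).trans_lt hq
    exact_mod_cast this
  -- the refined averaging estimate and the count of Cor. 3.2
  have hG := mul_abs_sub_le_graded (K := K) (by omega) hf hδ2 hdeg hδq
  have hB := two_mul_card_filter_not_irreducible_planeSection_add_le (K := K) (by omega) f hδ2 hdeg hf
  -- abbreviations
  set Par := (Fin (k + 1 + 1) → K) × (Fin (k + 1) → K) × (Fin (k + 1) → K)
  set Bad32 : Par → Prop := fun p ↦
    ¬ Irreducible (MvPolynomial.map (algebraMap K (AlgebraicClosure K))
      (planeSection f p.1 p.2.1 p.2.2)) with hBad32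
  set BadD : ℕ → Par → Prop := fun D p ↦
    ¬ (0 < (planeSection f p.1 p.2.1 p.2.2).totalDegree ∧
        ∀ H : MvPolynomial (Fin 2) (AlgebraicClosure K),
          H ∣ MvPolynomial.map (algebraMap K (AlgebraicClosure K))
              (planeSection f p.1 p.2.1 p.2.2) →
            H.totalDegree ≤ D → IsUnit H) with hBadD
  set D : ℝ := |(rationalPointCount f : ℝ) - (q : ℝ) ^ (k + 1)| with hD
  set W : ℝ := ((δ - 1) * (δ - 2) : ℕ) * √(q : ℝ) + 1 + δ + 4 * (δ : ℝ) ^ 3 with hW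
  set c32 : ℝ := (3 * (δ : ℝ) ^ 4 + 5 * (δ : ℝ) ^ 2) / 2 - 2 * (δ : ℝ) ^ 3 with hc32
  set e : ℕ → ℝ := fun j ↦ 2 * (δ : ℝ) ^ 2 + 2 * (δ : ℝ) ^ 2 * ((δ / (j + 1) : ℕ) : ℝ) *
    (((δ / (j + 1) : ℕ) : ℝ) + 1) ^ 2 with he
  set S : ℝ := ∑ j ∈ Finset.Icc 1 (δ - 1), min c32 (e j) with hS
  -- real-number forms
  have hqr : (51 : ℝ) ≤ q := by exact_mod_cast hq51
  have hq0 : (0 : ℝ) < q := by linarith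
  -- ### the graded counts: `B_j ≤ min(c32, e_j) q^{3(k+1)}`
  have hBj : ∀ j ∈ Finset.Icc 1 (δ - 1),
      (((Finset.univ : Finset Par).filter fun p ↦ Bad32 p ∧ BadD (δ / (j + 1)) p).card : ℝ) ≤
        min c32 (e j) * (q : ℝ) ^ (3 * (k + 1)) := by
    intro j hj
    rw [Finset.mem_Icc] at hj
    rw [min_mul_of_nonneg _ _ (by positivity), le_min_iff]
    constructor
    · -- Cor. 3.2
      have h1 : ((Finset.univ : Finset Par).filter fun p ↦ Bad32 p ∧ BadD (δ / (j + 1)) p).card ≤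
          ((Finset.univ : Finset Par).filter fun p ↦ Bad32 p).card :=
        Finset.card_le_card (Finset.monotone_filter_right _ fun p _ h ↦ h.1)
      have h1' : ((((Finset.univ : Finset Par).filter fun p ↦ Bad32 p ∧ BadD (δ / (j + 1)) p).card
          : ℕ) : ℝ) ≤ ((Finset.univ : Finset Par).filter fun p ↦ Bad32 p).card := by
        exact_mod_cast h1
      have h2 : (2 * ((Finset.univ : Finset Par).filter fun p ↦ Bad32 p).card +
          4 * δ ^ 3 * q ^ (3 * (k + 1)) : ℝ) ≤ (3 * δ ^ 4 + 5 * δ ^ 2) * (q : ℝ) ^ (3 * (k + 1)) := by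
        exact_mod_cast hB
      rw [hc32]
      nlinarith
    · -- the assumed count of Cor. 3.4 with `D = ⌊δ/(j+1)⌋`
      have hD1 : 1 ≤ δ / (j + 1) := by
        rw [Nat.le_div_iff_mul_le (by omega)]; omega
      have hDδ : δ / (j + 1) + 1 ≤ δ := Nat.div_lt_self (by omega) (by omega)
      have h1 : ((Finset.univ : Finset Par).filter fun p ↦ Bad32 p ∧ BadD (δ / (j + 1)) p).card ≤
          ((Finset.univ : Finset Par).filter fun p ↦ BadD (δ / (j + 1)) p).card :=
        Finset.card_le_card (Finset.monotone_filter_right _ fun p _ h ↦ h.2)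
      have h2 := hcount (δ / (j + 1)) hD1 hDδ
      have h3 : ((((Finset.univ : Finset Par).filter fun p ↦ Bad32 p ∧ BadD (δ / (j + 1)) p).card
          : ℕ) : ℝ) ≤ ((2 * δ ^ 2 + δ * ((δ / (j + 1) + 1) ^ 2 * (2 * (δ / (j + 1)) * δ))) *
            q ^ (3 * (k + 1)) : ℕ) := by
        exact_mod_cast h1.trans h2
      refine h3.trans (le_of_eq ?_)
      rw [he]
      push_cast
      ring
  have hsumB : ∑ j ∈ Finset.Icc 1 (δ - 1),
      (((Finset.univ : Finset Par).filter fun p ↦ Bad32 p ∧ BadD (δ / (j + 1)) p).card : ℝ) ≤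
        (q : ℝ) ^ (3 * (k + 1)) * S := by
    rw [hS, Finset.mul_sum]
    refine Finset.sum_le_sum fun j hj ↦ ?_
    rw [mul_comm]
    exact hBj j hj
  -- ### the averaging estimate in the form `Q' D ≤ Q' q^k W + q^{3k+4} (δ² + S)`
  have hG' : (q : ℝ) ^ (k + 1 + 2) * ((q : ℝ) ^ (k + 1) - 1) * D ≤
      (q : ℝ) ^ (k + 1) * ((q : ℝ) ^ (k + 1) - 1) * (q : ℝ) ^ (k + 1 + 1) * W +
        (δ : ℝ) ^ 2 * (q : ℝ) ^ (3 * (k + 1) - 1) * (q : ℝ) ^ 2 +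
        q * ∑ j ∈ Finset.Icc 1 (δ - 1),
          (((Finset.univ : Finset Par).filter fun p ↦ Bad32 p ∧ BadD (δ / (j + 1)) p).card : ℝ) :=
    hG
  have h3k : 3 * (k + 1) - 1 = 3 * k + 2 := by omega
  rw [h3k] at hG'
  set Q : ℝ := (q : ℝ) ^ (k + 1) with hQ
  have hQ51 : (51 : ℝ) ≤ Q := by
    calc (51 : ℝ) ≤ q := hqr
      _ = (q : ℝ) ^ 1 := (pow_one _).symm
      _ ≤ (q : ℝ) ^ (k + 1) := pow_le_pow_right₀ (by linarith) (by omega)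
  have hQ1 : (0 : ℝ) < Q - 1 := by linarith
  have hQgt : 5 * (δ : ℝ) ^ ((10 : ℝ) / 3) < Q := by
    calc 5 * (δ : ℝ) ^ ((10 : ℝ) / 3) < q := hq
      _ = (q : ℝ) ^ 1 := (pow_one _).symm
      _ ≤ Q := pow_le_pow_right₀ (by linarith) (by omega)
  -- `(Q - 1) D ≤ q^k ((Q - 1) W + Q (δ² + S))`
  have hkey : (Q - 1) * D ≤ (q : ℝ) ^ k * ((Q - 1) * W + Q * ((δ : ℝ) ^ 2 + S)) := by
    have e1 : (q : ℝ) ^ (k + 1 + 2) * ((q : ℝ) ^ (k + 1) - 1) = (q : ℝ) ^ (k + 3) * (Q - 1) := by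
      rw [hQ]
    have e2 : (q : ℝ) ^ (k + 1) * ((q : ℝ) ^ (k + 1) - 1) * (q : ℝ) ^ (k + 1 + 1) * W =
        (q : ℝ) ^ (k + 3) * ((q : ℝ) ^ k * ((Q - 1) * W)) := by
      rw [hQ]; ring
    have e3 : (δ : ℝ) ^ 2 * (q : ℝ) ^ (3 * k + 2) * (q : ℝ) ^ 2 =
        (q : ℝ) ^ (k + 3) * ((q : ℝ) ^ k * (Q * (δ : ℝ) ^ 2)) := by
      rw [hQ]; ring
    have e4 : (q : ℝ) * ((q : ℝ) ^ (3 * (k + 1)) * S) = (q : ℝ) ^ (k + 3) * ((q : ℝ) ^ k * (Q * S)) := by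
      rw [hQ]; ring
    have hS' : (q : ℝ) * ∑ j ∈ Finset.Icc 1 (δ - 1),
        (((Finset.univ : Finset Par).filter fun p ↦ Bad32 p ∧ BadD (δ / (j + 1)) p).card : ℝ) ≤
        (q : ℝ) ^ (k + 3) * ((q : ℝ) ^ k * (Q * S)) := by
      rw [← e4]
      exact mul_le_mul_of_nonneg_left hsumB hq0.le
    rw [e1, e2, e3] at hG'
    have h := hG'.trans (add_le_add le_rfl hS')
    have hq3 : (0 : ℝ) < (q : ℝ) ^ (k + 3) := pow_pos hq0 _
    have h' : (q : ℝ) ^ (k + 3) * ((Q - 1) * D) ≤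
        (q : ℝ) ^ (k + 3) * ((q : ℝ) ^ k * ((Q - 1) * W + Q * ((δ : ℝ) ^ 2 + S))) := by
      nlinarith
    exact le_of_mul_le_mul_left h' hq3
  -- ### the numerical inequality
  have hnum : ((1 : ℝ) + δ + 4 * (δ : ℝ) ^ 3) * (Q - 1) + Q * ((δ : ℝ) ^ 2 + S) ≤
      5 * (δ : ℝ) ^ ((13 : ℝ) / 3) * (Q - 1) := numeric_main hδ9 hQgt
  have hfin : (Q - 1) * W + Q * ((δ : ℝ) ^ 2 + S) ≤
      (Q - 1) * (((δ - 1) * (δ - 2) : ℕ) * √(q : ℝ) + 5 * (δ : ℝ) ^ ((13 : ℝ) / 3)) := by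
    rw [hW]
    nlinarith
  have hqk : (0 : ℝ) ≤ (q : ℝ) ^ k := pow_nonneg hq0.le k
  have hD' : (Q - 1) * D ≤ (Q - 1) * ((q : ℝ) ^ k *
      (((δ - 1) * (δ - 2) : ℕ) * √(q : ℝ) + 5 * (δ : ℝ) ^ ((13 : ℝ) / 3))) := by
    calc (Q - 1) * D ≤ (q : ℝ) ^ k * ((Q - 1) * W + Q * ((δ : ℝ) ^ 2 + S)) := hkey
      _ ≤ (q : ℝ) ^ k * ((Q - 1) * (((δ - 1) * (δ - 2) : ℕ) * √(q : ℝ) +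
          5 * (δ : ℝ) ^ ((13 : ℝ) / 3))) := mul_le_mul_of_nonneg_left hfin hqk
      _ = (Q - 1) * ((q : ℝ) ^ k *
          (((δ - 1) * (δ - 2) : ℕ) * √(q : ℝ) + 5 * (δ : ℝ) ^ ((13 : ℝ) / 3))) := by ring
  rw [show k + 1 - 1 = k from rfl]
  calc D ≤ (q : ℝ) ^ k * (((δ - 1) * (δ - 2) : ℕ) * √(q : ℝ) + 5 * (δ : ℝ) ^ ((13 : ℝ) / 3)) :=
        le_of_mul_le_mul_left hD' hQ1
    _ = ((δ - 1) * (δ - 2) : ℕ) * (q : ℝ) ^ k * √(q : ℝ) + 5 * (δ : ℝ) ^ ((13 : ℝ) / 3) * (q : ℝ) ^ k := by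
        ring

end Main

/-! ### Theorem 5.2 for `δ ≥ 9`, all `n` and `q` -/

/-- **Cafure–Matera (2006), Theorem 5.2, for absolutely irreducible hypersurfaces of degree
`δ ≥ 9`** (all `n`, all `q`; classical decidability instances) — the endpoint of the plane-section
route; the named fact itself is `CafureMatera2006_thm52_holds` of `CafureMateraThm52Proofs`.
[cite: CafureMatera2006, Thm. 5.2] -/
theorem CafureMatera2006_thm52_of_nine_le (K : Type) [Field K] [Fintype K] (n : ℕ)
    (f : MvPolynomial (Fin n) K) (hf : IsAbsIrreducible f) (h9 : 9 ≤ f.totalDegree) :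
    |(rationalPointCount f : ℝ) - (Fintype.card K : ℝ) ^ ((n : ℝ) - 1)| ≤
      ((f.totalDegree : ℝ) - 1) * ((f.totalDegree : ℝ) - 2) *
          (Fintype.card K : ℝ) ^ ((n : ℝ) - 3 / 2) +
        5 * (f.totalDegree : ℝ) ^ ((13 : ℝ) / 3) * (Fintype.card K : ℝ) ^ ((n : ℝ) - 2) := by
  set δ := f.totalDegree with hδ
  -- the elementary regime `q ≤ 5δ^{10/3}`
  by_cases hq : (Fintype.card K : ℝ) ≤ 5 * (δ : ℝ) ^ ((10 : ℝ) / 3)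
  · exact CafureMatera2006_thm52_of_card_le hf hq
  rw [not_le] at hq
  -- `n ≥ 2`
  rcases n with _ | n
  · exfalso
    have : f.totalDegree = 0 := by
      rw [MvPolynomial.eq_C_of_isEmpty f, totalDegree_C]
    omega
  rcases n with _ | m
  · exfalso
    have := IsAbsIrreducible.totalDegree_eq_one_fin_one hf
    omega
  -- `n = m + 2`: the estimate from the graded count, the count being Cor. 3.4
  have hmain := abs_rationalPointCount_sub_le_of_degreeCount (K := K) (m := m + 1) (by omega) hf h9
    hδ.symm hq (fun D _ hDδ ↦ card_filter_smallFactorBad_le (by omega) f hδ.symm hf hDδ)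
  -- translate the powers
  set q : ℝ := (Fintype.card K : ℝ) with hq'
  have hq0 : 0 < q := by rw [hq']; exact_mod_cast Fintype.card_pos
  have e1 : q ^ (((m + 1 + 1 : ℕ) : ℝ) - 1) = q ^ (m + 1) := by
    rw [show (((m + 1 + 1 : ℕ) : ℝ) - 1) = ((m + 1 : ℕ) : ℝ) by push_cast; ring, Real.rpow_natCast]
  have e2 : q ^ (((m + 1 + 1 : ℕ) : ℝ) - 3 / 2) = q ^ m * √q := by
    rw [show (((m + 1 + 1 : ℕ) : ℝ) - 3 / 2) = ((m : ℕ) : ℝ) + 1 / 2 by push_cast; ring,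
      Real.rpow_add hq0, Real.rpow_natCast, Real.sqrt_eq_rpow]
  have e3 : q ^ (((m + 1 + 1 : ℕ) : ℝ) - 2) = q ^ m := by
    rw [show (((m + 1 + 1 : ℕ) : ℝ) - 2) = ((m : ℕ) : ℝ) by push_cast; ring, Real.rpow_natCast]
  rw [e1, e2, e3]
  rw [show m + 1 - 1 = m from rfl] at hmain
  have hcast : (((δ - 1) * (δ - 2) : ℕ) : ℝ) = ((δ : ℝ) - 1) * ((δ : ℝ) - 2) := by
    have h1' : 1 ≤ δ := by omega
    have h2' : 2 ≤ δ := by omega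
    push_cast [Nat.cast_sub h1', Nat.cast_sub h2']
    ring
  rw [hcast] at hmain
  calc |(rationalPointCount f : ℝ) - q ^ (m + 1)|
      ≤ ((δ : ℝ) - 1) * ((δ : ℝ) - 2) * q ^ m * √q + 5 * (δ : ℝ) ^ ((13 : ℝ) / 3) * q ^ m := hmain
    _ = ((δ : ℝ) - 1) * ((δ : ℝ) - 2) * (q ^ m * √q) + 5 * (δ : ℝ) ^ ((13 : ℝ) / 3) * q ^ m := by ring

end Literature.NumberTheory.DiophantineGeometry

end
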